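import Summits.Ventures.Crystal3D.Theorems.StickyWulffConstantCoaxialWallLawSeamBiFrameRootRow
import Summits.Ventures.Crystal3D.Theorems.StickyWulffConstantCoaxialWallLawSeamThreePayerSplitE1
import Summits.Ventures.Crystal3D.Theorems.StickyWulffConstantCoaxialWallLawTwoLatticeEndMult
import HarnessLib

/-!
# `ThreePayerRoot` from E1 and the FIVE straight-kind census facts — no `SatCensus11Cross`
# (lane T, crux `TextureLiminfV5`, stmt-Ventures-23912, registered stub `stub_terraceCensus`; cf-p1 RULING (ccc)(2)(ii) «say what replaces ThreePayer for root-class moves»)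

HONEST FRAMING. Venture `Summits/Ventures/Crystal3D` (cell `crystal3d-full`), route `route-Ventures-StickyWulffConstant`.  CONDITIONAL glue: the hypotheses
`P5Exhaustion` (E1), `SatCensus12Narrow`, `SatCensus12Glide`, `SatCensus11Full`, `SatCensus11Narrow`, `SatCensus11Glide` are lane F's registered NAMED INPUTS
('…SeamThreePayerSplit', '…SeamThreePayerSplitE1'); none is proved here; F-C1 not moved.

THE POINT.  Lane F derives `ThreePayer` from E1 and SIX kind-restricted census facts (`threePayer_of_kinds_E1`), the sixth being `SatCensus11Cross` — the deg-11
census at CROSS ends, whose standing is «not closable by the current engine» (cf-p1 (cccii): 11 rigid 11-shells incl. 4 non-vacancy + 57 free-ball continua).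
A ROOT-CLASS end move is a STRAIGHT move (`isRootEndPair_straight`, '…SeamBiFrameRootRow'), so the three-payer floor AT ROOT-CLASS ENDS — all the bi-frame
root row of lane T needs (`endRowBiFrameRootA_of_threePayerRoot_of_biFrameWin₃`) — follows WITHOUT the cross fact:
* `two_unsaturated_of_isEndPairRootA_eleven (cF) (cN) (cG)` — two unsaturated contact-neighbours at a deg-11 root-class end ball;
* `census12_of_isEndPairRootA (hE1) (c12N) (c12G)` — total neighbour deficiency `≥ 3` at a saturated root-class end ball (FULL root ends are unsaturated by E1);
* **`threePayerRoot_of_kinds_E1 : P5Exhaustion → SatCensus12Narrow → SatCensus12Glide → SatCensus11Full → SatCensus11Narrow → SatCensus11Glide → ThreePayerRoot`**;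
* `endRowBiFrameRootA_of_kinds_E1_of_biFrameWin₃` — the LINK with the five facts + E1 in front.
WHAT THIS IS NOT: no census fact is proved; the certificate `BiFrameRootGradedCapWin₃` is not proved; F-C1 not moved.
-/

noncomputable section

namespace Summit.Ventures.Crystal3D.Theorems

namespace TailResidue

open Summit.Ventures.Crystal3D Finset
open scoped InnerProductSpace

open scoped Classical in
/-- **Two unsaturated contact-neighbours at a deg-11 ROOT-CLASS end ball, from the three straight-kind deg-11 facts** (no cross fact). -/
theorem two_unsaturated_of_isEndPairRootA_eleven (cF : SatCensus11Full) (cN : SatCensus11Narrow) (cG : SatCensus11Glide)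
    {X : Finset (EuclideanSpace ℝ (Fin 3))} (hX : ∀ p ∈ X, ∀ p' ∈ X, p ≠ p' → 1 ≤ dist p p') {v : WordVersion} {S₁ S₂ : PlateSystem}
    (h₁ : S₁.RT ⊆ fccSlots) (h₂ : S₂.RT ⊆ fccSlots) {b q : EuclideanSpace ℝ (Fin 3)} (hp : IsEndPairRootA X v S₁ S₂ b q)
    (h11 : (X.filter fun x => dist b x = 1).card = 11) :
    ∃ y ∈ X, ∃ y' ∈ X, y ≠ y' ∧ dist b y = 1 ∧ dist b y' = 1 ∧ (X.filter fun x => dist y x = 1).card ≤ 11 ∧ (X.filter fun x => dist y' x = 1).card ≤ 11 := by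
  rcases hp with hp | hp
  · obtain ⟨r, hr, hq, hb, h2p, hbq, hpred, hrd, hnm⟩ := isRootEndPair_straight h₁ hp
    have hadm : S₁.Adm S₁.G₀ (S₁.G₀ r) ∨ S₂.Adm S₁.G₀ (S₁.G₀ r) := Or.inl (PlateSystem.adm_root S₁ hr)
    rcases hrd with hf | hn | hg
    · exact cF X hX v S₁ S₂ h₁ h₂ b q S₁.G₀ (S₁.G₀ r) hq hb h2p hadm hpred hf hbq hnm h11
    · exact cN X hX v S₁ S₂ h₁ h₂ b q S₁.G₀ (S₁.G₀ r) hq hb h2p hadm hpred hn hbq hnm h11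
    · exact cG X hX v S₁ S₂ h₁ h₂ b q S₁.G₀ (S₁.G₀ r) hq hb h2p hadm hpred hg hbq hnm h11
  · obtain ⟨r, hr, hq, hb, h2p, hbq, hpred, hrd, hnm⟩ := isRootEndPair_straight h₂ hp
    have hadm : S₁.Adm S₂.G₀ (S₂.G₀ r) ∨ S₂.Adm S₂.G₀ (S₂.G₀ r) := Or.inr (PlateSystem.adm_root S₂ hr)
    rcases hrd with hf | hn | hg
    · exact cF X hX v S₁ S₂ h₁ h₂ b q S₂.G₀ (S₂.G₀ r) hq hb h2p hadm hpred hf hbq hnm h11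
    · exact cN X hX v S₁ S₂ h₁ h₂ b q S₂.G₀ (S₂.G₀ r) hq hb h2p hadm hpred hn hbq hnm h11
    · exact cG X hX v S₁ S₂ h₁ h₂ b q S₂.G₀ (S₂.G₀ r) hq hb h2p hadm hpred hg hbq hnm h11

open scoped Classical in
/-- **Total neighbour deficiency `≥ 3` at a SATURATED root-class end ball, from E1 and the two straight-kind deg-12 facts**: a FULL root end is unsaturated
('…SeamFullEndUnsaturated'), NARROW and GLIDE root ends are covered by the named inputs. -/
theorem census12_of_isEndPairRootA (hE1 : P5Exhaustion) (cN : SatCensus12Narrow) (cG : SatCensus12Glide)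
    {X : Finset (EuclideanSpace ℝ (Fin 3))} (hX : ∀ p ∈ X, ∀ p' ∈ X, p ≠ p' → 1 ≤ dist p p') {v : WordVersion} {S₁ S₂ : PlateSystem}
    (h₁ : S₁.RT ⊆ fccSlots) (h₂ : S₂.RT ⊆ fccSlots) {b q : EuclideanSpace ℝ (Fin 3)} (hp : IsEndPairRootA X v S₁ S₂ b q)
    (h12 : (X.filter fun x => dist b x = 1).card = 12) :
    3 ≤ ∑ y ∈ X.filter (fun y => dist b y = 1 ∧ (X.filter fun x => dist y x = 1).card ≤ 11), ((12 : ℝ) - ((X.filter fun x => dist y x = 1).card : ℝ)) := by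
  rcases hp with hp | hp
  · obtain ⟨r, hr, hq, hb, h2p, hbq, hpred, hrd, hnm⟩ := isRootEndPair_straight h₁ hp
    have hadm : S₁.Adm S₁.G₀ (S₁.G₀ r) ∨ S₂.Adm S₁.G₀ (S₁.G₀ r) := Or.inl (PlateSystem.adm_root S₁ hr)
    rcases hrd with hf | hn | hg
    · have := card_contacts_le_eleven_of_isEndPairA_full hE1 hX h₁ h₂ hq hadm hf hbq hnm
      omega
    · exact cN X hX v S₁ S₂ h₁ h₂ b q S₁.G₀ (S₁.G₀ r) hq hb h2p hadm hpred hn hbq hnm h12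
    · exact cG X hX v S₁ S₂ h₁ h₂ b q S₁.G₀ (S₁.G₀ r) hq hb h2p hadm hpred hg hbq hnm h12
  · obtain ⟨r, hr, hq, hb, h2p, hbq, hpred, hrd, hnm⟩ := isRootEndPair_straight h₂ hp
    have hadm : S₁.Adm S₂.G₀ (S₂.G₀ r) ∨ S₂.Adm S₂.G₀ (S₂.G₀ r) := Or.inr (PlateSystem.adm_root S₂ hr)
    rcases hrd with hf | hn | hg
    · have := card_contacts_le_eleven_of_isEndPairA_full hE1 hX h₁ h₂ hq hadm hf hbq hnm
      omega
    · exact cN X hX v S₁ S₂ h₁ h₂ b q S₂.G₀ (S₂.G₀ r) hq hb h2p hadm hpred hn hbq hnm h12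
    · exact cG X hX v S₁ S₂ h₁ h₂ b q S₂.G₀ (S₂.G₀ r) hq hb h2p hadm hpred hg hbq hnm h12

open scoped Classical in
/-- **`ThreePayerRoot` FROM E1 AND THE FIVE STRAIGHT-KIND CENSUS FACTS** (verbatim the bookkeeping of `threePayer_of_kinds_E1`, the cross fact dropped). -/
theorem threePayerRoot_of_kinds_E1 (hE1 : P5Exhaustion) (c12N : SatCensus12Narrow) (c12G : SatCensus12Glide) (cF : SatCensus11Full)
    (cN : SatCensus11Narrow) (cG : SatCensus11Glide) : ThreePayerRoot := by
  intro Y hY z hz hdeg v S₁ S₂ h₁ h₂ b q hzb hbz hp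
  have hb : b ∈ Y := (isEndPairA_of_isEndPairRootA hp).2.1
  set S := Y.filter (fun y => dist b y ≤ 1 ∧ (Y.filter fun x => dist y x = 1).card ≤ 11) with hS
  have hterm : ∀ y ∈ S, (1 : ℝ) ≤ (12 : ℝ) - ((Y.filter fun x => dist y x = 1).card : ℝ) := by
    intro y hy
    have : ((Y.filter fun x => dist y x = 1).card : ℝ) ≤ 11 := by exact_mod_cast (mem_filter.1 hy).2.2
    linarith
  have hnonneg : ∀ y ∈ S, (0 : ℝ) ≤ (12 : ℝ) - ((Y.filter fun x => dist y x = 1).card : ℝ) := fun y hy => (zero_le_one.trans (hterm y hy))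
  have hzS : z ∈ S := mem_filter.2 ⟨hz, by rwa [dist_comm], hdeg⟩
  have h12b := card_filter_dist_eq_one_le_twelve Y hY b
  unfold pooledDef
  by_cases h10 : (Y.filter fun x => dist b x = 1).card ≤ 10
  · have hbS : b ∈ S := mem_filter.2 ⟨hb, by simp, by omega⟩
    have hsub : ({b, z} : Finset (EuclideanSpace ℝ (Fin 3))) ⊆ S := insert_subset hbS (singleton_subset_iff.2 hzS)
    have hbterm : (2 : ℝ) ≤ (12 : ℝ) - ((Y.filter fun x => dist b x = 1).card : ℝ) := by
      have : ((Y.filter fun x => dist b x = 1).card : ℝ) ≤ 10 := by exact_mod_cast h10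
      linarith
    calc (3 : ℝ) ≤ ((12 : ℝ) - ((Y.filter fun x => dist b x = 1).card : ℝ)) + ((12 : ℝ) - ((Y.filter fun x => dist z x = 1).card : ℝ)) := by
          linarith [hterm z hzS]
      _ = ∑ y ∈ ({b, z} : Finset (EuclideanSpace ℝ (Fin 3))), ((12 : ℝ) - ((Y.filter fun x => dist y x = 1).card : ℝ)) := by rw [sum_pair hbz]
      _ ≤ ∑ y ∈ S, ((12 : ℝ) - ((Y.filter fun x => dist y x = 1).card : ℝ)) := sum_le_sum_of_subset_of_nonneg hsub fun y hy _ => hnonneg y hy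
  · by_cases h11 : (Y.filter fun x => dist b x = 1).card = 11
    · obtain ⟨y, hy, y', hy', hne, hd, hd', hle, hle'⟩ := two_unsaturated_of_isEndPairRootA_eleven cF cN cG hY h₁ h₂ hp h11
      have hbS : b ∈ S := mem_filter.2 ⟨hb, by simp, by omega⟩
      have hyS : y ∈ S := mem_filter.2 ⟨hy, hd.le, hle⟩
      have hy'S : y' ∈ S := mem_filter.2 ⟨hy', hd'.le, hle'⟩
      have hby : b ≠ y := fun h => by rw [← h, dist_self] at hd; exact zero_ne_one hd
      have hby' : b ≠ y' := fun h => by rw [← h, dist_self] at hd'; exact zero_ne_one hd'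
      have hsub : ({b, y, y'} : Finset (EuclideanSpace ℝ (Fin 3))) ⊆ S := insert_subset hbS (insert_subset hyS (singleton_subset_iff.2 hy'S))
      have hcard : ({b, y, y'} : Finset (EuclideanSpace ℝ (Fin 3))).card = 3 := by
        rw [card_insert_of_notMem (by simp [hby, hby']), card_pair hne]
      calc (3 : ℝ) = ∑ _y ∈ ({b, y, y'} : Finset (EuclideanSpace ℝ (Fin 3))), (1 : ℝ) := by simp [hcard]
        _ ≤ ∑ w ∈ ({b, y, y'} : Finset (EuclideanSpace ℝ (Fin 3))), ((12 : ℝ) - ((Y.filter fun x => dist w x = 1).card : ℝ)) :=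
            sum_le_sum fun w hw => hterm w (hsub hw)
        _ ≤ ∑ w ∈ S, ((12 : ℝ) - ((Y.filter fun x => dist w x = 1).card : ℝ)) := sum_le_sum_of_subset_of_nonneg hsub fun w hw _ => hnonneg w hw
    · have h12 : (Y.filter fun x => dist b x = 1).card = 12 := by omega
      have hsum := census12_of_isEndPairRootA hE1 c12N c12G hY h₁ h₂ hp h12
      refine hsum.trans (sum_le_sum_of_subset_of_nonneg (fun y hy => ?_) fun y hy _ => hnonneg y hy)
      obtain ⟨hyY, hd, hle⟩ := mem_filter.1 hy
      exact mem_filter.2 ⟨hyY, hd.le, hle⟩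

/-- **THE LINK with the five straight-kind facts + E1 in front**: `… → BiFrameRootGradedCapWin₃ s → EndRowBiFrameRootA v2 s`. -/
theorem endRowBiFrameRootA_of_kinds_E1_of_biFrameWin₃ (hE1 : P5Exhaustion) (c12N : SatCensus12Narrow) (c12G : SatCensus12Glide)
    (cF : SatCensus11Full) (cN : SatCensus11Narrow) (cG : SatCensus11Glide) {s : ℝ} (h : BiFrameRootGradedCapWin₃ s) :
    EndRowBiFrameRootA WordVersion.v2 s :=
  endRowBiFrameRootA_of_threePayerRoot_of_biFrameWin₃ (threePayerRoot_of_kinds_E1 hE1 c12N c12G cF cN cG) h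

end TailResidue

end Summit.Ventures.Crystal3D.Theorems

end
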